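import Mathlib
import HarnessLib
import Literature.NumberTheory.DiophantineGeometry.AbcWave0
import Literature.NumberTheory.DiophantineGeometry.RothPrelim
import Literature.NumberTheory.DiophantineGeometry.RothTaylor
import Literature.NumberTheory.DiophantineGeometry.RothNearbyRationals
import Literature.NumberTheory.DiophantineGeometry.RothIndexTheorem

/-!
# Roth's theorem after Schmidt (LNM 785, Ch. V) — §11: conclusion of the proof

Source: W. M. Schmidt, *Diophantine Approximation*, LNM 785 (1980), Ch. V §11 (book pp. 133–134)
and the reduction to algebraic integers of §5 (p. 122) [Schmidt1980]; the target is the named fact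
`Literature.NumberTheory.DiophantineGeometry.roth` (`AbcWave0.lean`, **abc.S13**, Roth 1955).

**Main result** (`roth_of_rothLemma`, PROVED): Roth's Lemma 10A — taken as an explicit
hypothesis, stated in the vocabulary of `RothPrelim` exactly as printed with Schmidt's parameter
`γ = 1` (hypotheses (10.1)–(10.6), conclusion "index `≤ ε`" as a witness `P_i(p/q) ≠ 0` with
`Σ i_h/r_h ≤ ε`) — implies `roth`. The Index Theorem 7A is `Roth.indexTheorem`
(`RothIndexTheorem.lean`) and Theorem 8A is `Roth.indexGe_nearbyRationals`
(`RothNearbyRationals.lean`); both are used, not assumed. Once 10A is landed as a theorem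
(`RothLemma…`; seat-1 is on it, taking Lemma 9A from `RothWronskian…`), `roth_holds` is the
one-line `roth_of_rothLemma Roth.rothLemma`.

The §11 argument as formalised (`Roth.false_of_liouvilleWith`): for an algebraic integer `β`
of degree `≥ 2` that is `LiouvilleWith p`, `p > 2`: (i) `δ = min(1/2, (p-2)/2)`, so `0 < δ < 1` and
`|β - m/n| < n^{-2-δ}` infinitely often (`LiouvilleWith.frequently_lt_rpow_neg`); (ii) `ε = δ/37`;
(iii) `m = ⌈16ε⁻² log 4d⌉ + 2`, `ω = ω(m,ε) < 1` (`Roth.omega_le_half`); `B` from 7A, `D` from 8A;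
(iv)–(v) reduced approximations `p_h/q_h` with `q_h > T` — forcing `q^ω > B^m`, `q^δ > D`,
`q^ω ≥ 2^{3m}`, `q ≥ 2` — and `ω log q_{h+1} ≥ 2 log q_h` (`Roth.exists_rat_den_gt`: among reduced
fractions only finitely many have denominator `≤ N` near an irrational; `Roth.exists_chain`);
(vi)–(vii) `r₁ = ⌈log qₘ/(ε log q₁)⌉ + 1`, `r_h = ⌊r₁ log q₁/log q_h⌋ + 1`, whence (8.4), (10.3),
(10.4), `Σ r_h ≤ m r₁` and (10.6); then 8A gives index `≥ εm` and 10A a witness of index `≤ ε`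
at `(p_h/q_h)`, contradicting `ε < εm`. The reduction `x ↦ a₀x` uses
`IsAlgebraic.exists_integral_multiple`, `irrational_intCast_mul_iff`, `LiouvilleWith.int_mul`,
`minpoly.two_le_natDegree_iff`.

## References

* [Schmidt1980] W. M. Schmidt, *Diophantine Approximation*, LNM 785, Springer 1980, Ch. V §5
  (p. 122), §11 (pp. 133–134); Theorems 7A, 8A, 10A.
* [Roth1955] K. F. Roth, *Rational approximations to algebraic numbers*, Mathematika 2 (1955).
-/

noncomputable section

namespace Literature.NumberTheory.DiophantineGeometry

open MvPolynomial

namespace Roth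

open Filter Real

/-! ### Step 1: a supply of reduced approximations with large denominators -/

/-- If `β` is irrational and `|β - m/n| < n^{-κ}` (`κ > 0`) has solutions with arbitrarily large
`n`, then it has solutions *in lowest terms* with arbitrarily large denominator: the finitely
many fractions with denominator `≤ N` near `β` stay at positive distance from `β`.
[cite: Schmidt1980, Ch. V §11 (iv)–(v)] -/
theorem exists_rat_den_gt {β : ℝ} (hβ : Irrational β) {κ : ℝ} (hκ : 0 < κ)
    (hfreq : ∃ᶠ n : ℕ in atTop, ∃ m : ℤ, β ≠ m / n ∧ |β - m / n| < (n : ℝ) ^ (-κ))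
    (N : ℕ) : ∃ r : ℚ, N < r.den ∧ |β - r| < (r.den : ℝ) ^ (-κ) := by
  classical
  set A : Set ℚ := {r : ℚ | r.den ≤ N ∧ |β - r| < 1} with hA_def
  -- `A` is finite: numerators and denominators are bounded
  have hAfin : A.Finite := by
    set M : ℤ := ⌈(|β| + 1) * N⌉ with hM
    have hsub : A ⊆ (fun r : ℚ => (r.num, r.den)) ⁻¹'
        ((Finset.Icc (-M) M ×ˢ Finset.Icc 1 N : Finset (ℤ × ℕ)) : Set (ℤ × ℕ)) := by
      intro r hr
      obtain ⟨hden, hdist⟩ := hr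
      have hdenpos : 0 < r.den := r.den_pos
      have hrabs : |(r : ℝ)| ≤ |β| + 1 := by
        have h1 : |(r : ℝ)| ≤ |β| + |β - r| := by
          calc |(r : ℝ)| = |β - (β - r)| := by ring_nf
            _ ≤ |β| + |β - r| := abs_sub _ _
        linarith
      have hnum : |(r.num : ℝ)| ≤ (|β| + 1) * N := by
        have hcast : (r : ℝ) = r.num / r.den := Rat.cast_def r
        have hdenR : (0 : ℝ) < r.den := by exact_mod_cast hdenpos
        have : (r.num : ℝ) = (r : ℝ) * r.den := by rw [hcast]; field_simp
        rw [this, abs_mul, Nat.abs_cast]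
        have hdenN : (r.den : ℝ) ≤ N := by exact_mod_cast hden
        calc |(r : ℝ)| * r.den ≤ (|β| + 1) * r.den := by gcongr
          _ ≤ (|β| + 1) * N := by gcongr
      have hnumM : |r.num| ≤ M := by
        have h1 : (|r.num| : ℝ) ≤ (|β| + 1) * N := by exact_mod_cast hnum
        have h2 : ((|β| + 1) * N : ℝ) ≤ M := Int.le_ceil _
        exact_mod_cast h1.trans h2
      simp only [Set.mem_preimage, Finset.coe_product, Finset.coe_Icc, Set.mem_prod, Set.mem_Icc]
      exact ⟨⟨by linarith [abs_le.mp hnumM |>.1], (le_abs_self _).trans hnumM⟩, hdenpos, hden⟩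
    refine Set.Finite.subset (Set.Finite.preimage ?_ (Finset.finite_toSet _)) hsub
    intro r₁ _ r₂ _ h
    simp only [Prod.mk.injEq] at h
    exact Rat.ext h.1 h.2
  -- a positive lower bound for the distances from `β` to the elements of `A`, at most `1`
  obtain ⟨ε₀, hε₀, hε₀1, hAε⟩ : ∃ ε₀ : ℝ, 0 < ε₀ ∧ ε₀ ≤ 1 ∧ ∀ r ∈ A, ε₀ ≤ |β - r| := by
    set s : Finset ℝ := insert (1 : ℝ) (hAfin.toFinset.image fun r : ℚ => |β - r|) with hs
    have hsne : s.Nonempty := Finset.insert_nonempty _ _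
    refine ⟨s.min' hsne, ?_, Finset.min'_le _ _ (Finset.mem_insert_self _ _), ?_⟩
    · have hmem := Finset.min'_mem s hsne
      rcases Finset.mem_insert.mp hmem with h | h
      · rw [h]; exact one_pos
      · obtain ⟨r, -, hr⟩ := Finset.mem_image.mp h
        rw [← hr]
        exact abs_pos.mpr (sub_ne_zero.mpr (hβ.ne_rat r))
    · intro r hr
      exact Finset.min'_le _ _
        (Finset.mem_insert_of_mem (Finset.mem_image_of_mem _ (hAfin.mem_toFinset.mpr hr)))
  -- pick a large solution
  have h1 : ∀ᶠ n : ℕ in atTop, (n : ℝ) ^ (-κ) < ε₀ :=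
    ((tendsto_rpow_neg_atTop hκ).comp tendsto_natCast_atTop_atTop).eventually
      (gt_mem_nhds hε₀)
  have h2 : ∀ᶠ n : ℕ in atTop, N < n := eventually_gt_atTop N
  obtain ⟨n, ⟨m, -, hlt⟩, hn1, hn2⟩ := (hfreq.and_eventually (h1.and h2)).exists
  have hnpos : 0 < n := lt_of_le_of_lt (Nat.zero_le _) hn2
  set r : ℚ := (m : ℚ) / (n : ℚ) with hr_def
  have hrcast : (r : ℝ) = (m : ℝ) / n := by rw [hr_def]; push_cast; rfl
  have hdvd : (r.den : ℤ) ∣ (n : ℤ) := by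
    have := Rat.den_dvd m n
    rwa [Rat.divInt_eq_div, Int.cast_natCast] at this
  have hden_le : r.den ≤ n := by
    have := Int.le_of_dvd (by exact_mod_cast hnpos) hdvd
    exact_mod_cast this
  have hdist : |β - r| < (r.den : ℝ) ^ (-κ) := by
    rw [hrcast]
    refine hlt.trans_le ?_
    have hdenpos : (0 : ℝ) < r.den := by exact_mod_cast r.den_pos
    exact Real.rpow_le_rpow_of_nonpos hdenpos (by exact_mod_cast hden_le) (by linarith)
  refine ⟨r, ?_, hdist⟩
  by_contra hcon
  push Not at hcon
  have hrA : r ∈ A := by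
    refine ⟨hcon, ?_⟩
    rw [hrcast]
    exact hlt.trans_le (hn1.le.trans hε₀1)
  have := hAε r hrA
  rw [hrcast] at this
  linarith

/-! ### Step 2: a chain of approximations with rapidly increasing denominators -/

/-- From an unlimited supply of good reduced approximations one extracts a sequence whose
denominators exceed `N₀` and grow at least like `q_{k+1} ≥ q_k^c`.
[cite: Schmidt1980, Ch. V §11 (v)] -/
theorem exists_chain {β κ : ℝ}
    (hsupply : ∀ N : ℕ, ∃ r : ℚ, N < r.den ∧ |β - r| < (r.den : ℝ) ^ (-κ))
    (N₀ : ℕ) (c : ℝ) :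
    ∃ g : ℕ → ℚ, (∀ k, |β - g k| < ((g k).den : ℝ) ^ (-κ)) ∧ (∀ k, N₀ < (g k).den) ∧
      (∀ k, ((g k).den : ℝ) ^ c ≤ (g (k + 1)).den) ∧ (∀ k, (g k).den < (g (k + 1)).den) := by
  choose f hf1 hf2 using hsupply
  let step : ℚ → ℚ := fun r => f (max ⌈((r.den : ℝ)) ^ c⌉₊ (max r.den N₀))
  let g : ℕ → ℚ := fun k => Nat.rec (f N₀) (fun _ r => step r) k
  have hg0 : g 0 = f N₀ := rfl
  have hgs : ∀ k, g (k + 1) = step (g k) := fun k => rfl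
  refine ⟨g, ?_, ?_, ?_, ?_⟩
  · intro k
    cases k with
    | zero => rw [hg0]; exact hf2 _
    | succ k => rw [hgs]; exact hf2 _
  · intro k
    cases k with
    | zero => rw [hg0]; exact hf1 _
    | succ k =>
      rw [hgs]
      exact lt_of_le_of_lt ((le_max_right _ _).trans (le_max_right _ _)) (hf1 _)
  · intro k
    rw [hgs]
    have h1 := hf1 (max ⌈(((g k).den : ℝ)) ^ c⌉₊ (max (g k).den N₀))
    have h2 : ⌈(((g k).den : ℝ)) ^ c⌉₊ < (step (g k)).den := lt_of_le_of_lt (le_max_left _ _) h1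
    exact (Nat.le_ceil _).trans (by exact_mod_cast h2.le)
  · intro k
    rw [hgs]
    exact lt_of_le_of_lt ((le_max_left _ _).trans (le_max_right _ _)) (hf1 _)


/-! ### Step 3: the parameter `ω(m, ε)` -/

/-- `ω(m, ε) ≤ ε/2` for `m ≥ 2` and `0 ≤ ε ≤ 12` (so `ω < 1` in §11).
[cite: Schmidt1980, Ch. V §11] -/
theorem omega_le_half {m : ℕ} (hm : 2 ≤ m) {ε : ℝ} (hε0 : 0 ≤ ε) (hε : ε ≤ 12) :
    omega m ε ≤ ε / 2 := by
  unfold omega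
  have h1 : (24 : ℝ) * 2⁻¹ ^ m ≤ 6 := by
    have : (2⁻¹ : ℝ) ^ m ≤ 2⁻¹ ^ 2 := pow_le_pow_of_le_one (by norm_num) (by norm_num) hm
    norm_num at this ⊢
    linarith
  have h2 : (ε / 12) ^ 2 ^ (m - 1) ≤ ε / 12 :=
    pow_le_of_le_one (by positivity) (by linarith) (pow_ne_zero _ two_ne_zero)
  calc 24 * 2⁻¹ ^ m * (ε / 12) ^ 2 ^ (m - 1) ≤ 6 * (ε / 12) :=
        mul_le_mul h1 h2 (by positivity) (by norm_num)
    _ = ε / 2 := by ring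

/-! ### Step 4: Schmidt's §11 for an algebraic integer -/

/-- **Conclusion of the proof of Roth's theorem** (Schmidt, Ch. V §11) for a real algebraic
*integer* `β` of degree `≥ 2`, from the Index Theorem 7A (`Roth.indexTheorem`), Theorem 8A
(`Roth.indexGe_nearbyRationals`) and Roth's lemma 10A (hypothesis `h10`, `γ = 1`):
if `β` were `LiouvilleWith p` for some `p > 2`, pick `0 < δ < 1` with `2 + δ < p`,
`ε = δ/37`, `m > 16 ε⁻² log 4d`, reduced approximations `p₁/q₁, …, pₘ/qₘ` with
`q₁^ω > Bᵐ`, `q₁^δ > D`, `q₁^ω ≥ 2^{3m}` and `ω log q_{h+1} ≥ 2 log q_h`, degrees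
`r₁ ≥ log qₘ/(ε log q₁)`, `r_h = ⌊r₁ log q₁ / log q_h⌋ + 1`; then the auxiliary polynomial of
7A has index `≥ εm` at `(p_h/q_h)` by 8A and `≤ ε` by 10A, a contradiction since `m ≥ 2`.
[cite: Schmidt1980, Ch. V §11] -/
theorem false_of_liouvilleWith
    (h10 : (∀ (m : ℕ) (hm : 0 < m) (ε : ℝ), 0 < ε → ε < 1 / 12 →
      ∀ (r : Fin m → ℕ), (∀ h, 0 < r h) →
        (∀ h h' : Fin m, (h : ℕ) + 1 = h' → (r h' : ℝ) ≤ omega m ε * r h) →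
      ∀ (p : Fin m → ℤ) (q : Fin m → ℕ), (∀ h, 0 < q h) → (∀ h, Nat.Coprime (p h).natAbs (q h)) →
        (∀ h, (q ⟨0, hm⟩ : ℝ) ^ (r ⟨0, hm⟩) ≤ (q h : ℝ) ^ (r h)) →
        (∀ h, (2 : ℝ) ^ (3 * m) ≤ (q h : ℝ) ^ omega m ε) →
      ∀ (P : MvPolynomial (Fin m) ℤ), P ≠ 0 → (∀ h, P.degreeOf h ≤ r h) →
        (height P : ℝ) ≤ (q ⟨0, hm⟩ : ℝ) ^ (omega m ε * r ⟨0, hm⟩) →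
        ∃ i : Fin m →₀ ℕ, wt r i ≤ ε ∧ aeval (fun h => (p h : ℝ) / q h) (hasseD i P) ≠ 0))
    {β : ℝ} (hint : IsIntegral ℤ β) (hdeg : 2 ≤ (minpoly ℤ β).natDegree) (hirr : Irrational β)
    {p : ℝ} (hp : 2 < p) (hL : LiouvilleWith p β) : False := by
  classical
  /- (i) the exponent `2 + δ` with `0 < δ < 1` -/
  set δ : ℝ := min (1 / 2) ((p - 2) / 2) with hδ_def
  have hδ0 : 0 < δ := lt_min (by norm_num) (by linarith)
  have hδ1 : δ < 1 := (min_le_left _ _).trans_lt (by norm_num)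
  have h2δ : 2 + δ < p := by
    have := min_le_right (1 / 2 : ℝ) ((p - 2) / 2); linarith
  have hsupply : ∀ N : ℕ, ∃ r : ℚ, N < r.den ∧ |β - r| < (r.den : ℝ) ^ (-(2 + δ)) :=
    exists_rat_den_gt hirr (by linarith) (hL.frequently_lt_rpow_neg h2δ)
  /- (ii) `ε` -/
  set ε : ℝ := δ / 37 with hε_def
  have hε0 : 0 < ε := by positivity
  have hε36 : ε < δ / 36 := by
    rw [hε_def]; exact div_lt_div_of_pos_left hδ0 (by norm_num) (by norm_num)
  have hε12 : ε < 1 / 12 := by linarith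
  have hε1 : ε ≤ 1 := by linarith
  /- (iii) `m` and `ω` -/
  set d : ℕ := (minpoly ℤ β).natDegree with hd_def
  set m : ℕ := ⌈16 / ε ^ 2 * Real.log (4 * d)⌉₊ + 2 with hm_def
  have hm2 : 2 ≤ m := Nat.le_add_left _ _
  have hm0 : 0 < m := lt_of_lt_of_le two_pos hm2
  have hmlog : 16 / ε ^ 2 * Real.log (4 * d) < m := by
    rw [hm_def]; push_cast
    have := Nat.le_ceil (16 / ε ^ 2 * Real.log (4 * d)); linarith
  set ω : ℝ := omega m ε with hω_def
  have hω0 : 0 < ω := omega_pos hε0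
  have hω1 : ω < 1 := (omega_le_half hm2 hε0.le (by linarith)).trans_lt (by linarith)
  have h2ω : 1 < 2 / ω := by rw [lt_div_iff₀ hω0]; linarith
  /- the constants `B = B(β)` of 7A and `D = D(β, B)` of 8A -/
  obtain ⟨B₀, hB₀1, hB₀⟩ := indexTheorem β (minpoly ℤ β) (minpoly.monic hint) hdeg (minpoly.aeval ℤ β)
  set B : ℝ := (B₀ : ℝ) with hB_def
  have hB1 : 1 ≤ B := by rw [hB_def]; exact_mod_cast hB₀1
  obtain ⟨D, hD0, hD⟩ := indexGe_nearbyRationals β B hB1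
  /- (iv)-(v) the approximations `p_h/q_h`, `q_h > T` -/
  set T : ℝ := max (max ((B ^ m) ^ ω⁻¹) (D ^ δ⁻¹)) (max (((2 : ℝ) ^ (3 * m)) ^ ω⁻¹) 2)
    with hT_def
  set N₀ : ℕ := ⌈T⌉₊ with hN₀_def
  obtain ⟨g, hg_approx, hg_N₀, hg_grow, hg_mono⟩ := exists_chain hsupply N₀ (2 / ω)
  set pn : Fin m → ℤ := fun h => (g h).num with hpn_def
  set q : Fin m → ℕ := fun h => (g h).den with hq_def
  have hq0 : ∀ h, 0 < q h := fun h => (g h).den_pos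
  have hqR0 : ∀ h, (0 : ℝ) < q h := fun h => by exact_mod_cast hq0 h
  have hcop : ∀ h, Nat.Coprime (pn h).natAbs (q h) := fun h => (g h).reduced
  have happrox : ∀ h, |β - pn h / q h| < (q h : ℝ) ^ (-(2 + δ)) := fun h => by
    have := hg_approx h
    rwa [Rat.cast_def] at this
  have hqT : ∀ h, T < q h := fun h =>
    calc T ≤ N₀ := Nat.le_ceil T
      _ < q h := by exact_mod_cast hg_N₀ h
  have hq2 : ∀ h, (2 : ℝ) < q h := fun h =>
    lt_of_le_of_lt ((le_max_right _ _).trans (le_max_right _ _)) (hqT h)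
  have key : ∀ {a t x : ℝ}, 0 ≤ a → 0 < t → a ^ t⁻¹ < x → a < x ^ t := by
    intro a t x ha ht h
    calc a = (a ^ t⁻¹) ^ t := (Real.rpow_inv_rpow ha ht.ne').symm
      _ < x ^ t := Real.rpow_lt_rpow (Real.rpow_nonneg ha _) h ht
  have hqB : ∀ h, B ^ m < (q h : ℝ) ^ ω := fun h =>
    key (by positivity) hω0 (lt_of_le_of_lt ((le_max_left _ _).trans (le_max_left _ _)) (hqT h))
  have hqD : ∀ h, D < (q h : ℝ) ^ δ := fun h =>
    key hD0.le hδ0 (lt_of_le_of_lt ((le_max_right _ _).trans (le_max_left _ _)) (hqT h))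
  have hq3m : ∀ h, (2 : ℝ) ^ (3 * m) ≤ (q h : ℝ) ^ ω := fun h =>
    (key (by positivity) hω0
      (lt_of_le_of_lt ((le_max_left _ _).trans (le_max_right _ _)) (hqT h))).le
  -- monotonicity and growth of the denominators
  have hgmono : StrictMono fun k => (g k).den := strictMono_nat_of_lt_succ hg_mono
  have hqlt : ∀ h h' : Fin m, h < h' → q h < q h' := fun h h' hh => hgmono hh
  have hqle : ∀ h h' : Fin m, h ≤ h' → q h ≤ q h' := fun h h' hh => hgmono.monotone hh
  have hLgrow : ∀ h h' : Fin m, (h : ℕ) + 1 = h' →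
      (2 / ω) * Real.log (q h) ≤ Real.log (q h') := by
    intro h h' hh
    have h0 : ((g h).den : ℝ) ^ (2 / ω) ≤ (g ((h : ℕ) + 1)).den := hg_grow h
    rw [hh] at h0
    have h1 := Real.log_le_log (Real.rpow_pos_of_pos (hqR0 h) _) h0
    rwa [Real.log_rpow (hqR0 h)] at h1
  have hL0 : ∀ h, 0 < Real.log (q h) := fun h => Real.log_pos (by linarith [hq2 h])
  have hLle : ∀ h h' : Fin m, h ≤ h' → Real.log (q h) ≤ Real.log (q h') := fun h h' hh =>
    Real.log_le_log (hqR0 h) (by exact_mod_cast hqle h h' hh)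
  have hLlt : ∀ h h' : Fin m, h < h' → Real.log (q h) < Real.log (q h') := fun h h' hh =>
    Real.log_lt_log (hqR0 h) (by exact_mod_cast hqlt h h' hh)
  /- (vi)-(vii) the degrees `r_h` -/
  set i₀ : Fin m := ⟨0, hm0⟩ with hi₀_def
  set iₗ : Fin m := ⟨m - 1, by omega⟩ with hiₗ_def
  have hi₀le : ∀ h : Fin m, i₀ ≤ h := fun h => Fin.mk_le_of_le_val (Nat.zero_le _)
  have hleₗ : ∀ h : Fin m, h ≤ iₗ := fun h => by
    rw [Fin.le_def]; have := h.isLt; simp only [hiₗ_def]; omega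
  set r₁ : ℕ := ⌈Real.log (q iₗ) / (ε * Real.log (q i₀))⌉₊ + 1 with hr₁_def
  have hr₁pos : 0 < r₁ := Nat.succ_pos _
  have hr₁R : (0 : ℝ) < r₁ := by exact_mod_cast hr₁pos
  have hr₁ge : Real.log (q iₗ) ≤ ε * r₁ * Real.log (q i₀) := by
    have h1 : Real.log (q iₗ) / (ε * Real.log (q i₀)) ≤ r₁ := by
      rw [hr₁_def]; push_cast
      exact (Nat.le_ceil _).trans (by linarith)
    rw [div_le_iff₀ (mul_pos hε0 (hL0 i₀))] at h1
    linarith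
  set r : Fin m → ℕ := fun h =>
    if h = i₀ then r₁ else ⌊(r₁ : ℝ) * Real.log (q i₀) / Real.log (q h)⌋₊ + 1 with hr_def
  have hri₀ : r i₀ = r₁ := by simp [hr_def]
  have hr_of_ne : ∀ h, h ≠ i₀ →
      r h = ⌊(r₁ : ℝ) * Real.log (q i₀) / Real.log (q h)⌋₊ + 1 := fun h hh => by
    simp [hr_def, hh]
  have hr0 : ∀ h, 0 < r h := by
    intro h; by_cases hh : h = i₀
    · rw [hh, hri₀]; exact hr₁pos
    · rw [hr_of_ne h hh]; exact Nat.succ_pos _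
  -- (8.4), lower half: `r₁ log q₁ ≤ r_h log q_h`
  have hR1 : ∀ h, (r i₀ : ℝ) * Real.log (q i₀) ≤ r h * Real.log (q h) := by
    intro h; by_cases hh : h = i₀
    · rw [hh]
    · rw [hri₀, hr_of_ne h hh]
      have hx : (r₁ : ℝ) * Real.log (q i₀) / Real.log (q h) <
          (⌊(r₁ : ℝ) * Real.log (q i₀) / Real.log (q h)⌋₊ : ℝ) + 1 := Nat.lt_floor_add_one _
      rw [div_lt_iff₀ (hL0 h)] at hx
      push_cast
      linarith
  -- (8.4), upper half: `r_h log q_h ≤ (1 + ε) r₁ log q₁`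
  have hR2 : ∀ h, (r h : ℝ) * Real.log (q h) ≤ (1 + ε) * (r i₀ * Real.log (q i₀)) := by
    intro h; by_cases hh : h = i₀
    · rw [hh, hri₀]
      have := mul_nonneg hε0.le (mul_pos hr₁R (hL0 i₀)).le
      linarith
    · rw [hri₀, hr_of_ne h hh]
      have hx : (⌊(r₁ : ℝ) * Real.log (q i₀) / Real.log (q h)⌋₊ : ℝ) ≤
          (r₁ : ℝ) * Real.log (q i₀) / Real.log (q h) := Nat.floor_le (by positivity)
      have h1 := mul_le_mul_of_nonneg_right hx (hL0 h).le
      rw [div_mul_cancel₀ _ (hL0 h).ne'] at h1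
      have h2 : Real.log (q h) ≤ Real.log (q iₗ) := hLle h iₗ (hleₗ h)
      push_cast
      linarith [hr₁ge]
  -- `r_h ≤ r₁`, hence `∑ r_h ≤ m r₁`
  have hR3 : ∀ h, r h ≤ r₁ := by
    intro h; by_cases hh : h = i₀
    · rw [hh, hri₀]
    · rw [hr_of_ne h hh]
      have hlt : i₀ < h := lt_of_le_of_ne (hi₀le h) (Ne.symm hh)
      have hx : (r₁ : ℝ) * Real.log (q i₀) / Real.log (q h) < r₁ := by
        rw [div_lt_iff₀ (hL0 h)]
        exact mul_lt_mul_of_pos_left (hLlt i₀ h hlt) hr₁R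
      have : ⌊(r₁ : ℝ) * Real.log (q i₀) / Real.log (q h)⌋₊ < r₁ :=
        (Nat.floor_lt (by positivity)).mpr hx
      omega
  have hsum : ∑ h, r h ≤ m * r₁ :=
    calc ∑ h, r h ≤ ∑ _h : Fin m, r₁ := Finset.sum_le_sum fun h _ => hR3 h
      _ = m * r₁ := by simp
  -- (10.3): `r_{h+1} ≤ ω r_h`
  have hR4 : ∀ h h' : Fin m, (h : ℕ) + 1 = h' → (r h' : ℝ) ≤ omega m ε * r h := by
    intro h h' hh
    have h1 : (r h' : ℝ) * Real.log (q h') ≤ (1 + ε) * (r h * Real.log (q h)) :=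
      (hR2 h').trans (mul_le_mul_of_nonneg_left (hR1 h) (by linarith))
    have h2 := hLgrow h h' hh
    have h3 : ((r h' : ℝ) * (2 / ω)) * Real.log (q h) ≤ ((1 + ε) * r h) * Real.log (q h) := by
      have := mul_le_mul_of_nonneg_left h2 (Nat.cast_nonneg (r h'))
      linarith
    have h4 : (r h' : ℝ) * (2 / ω) ≤ (1 + ε) * r h := le_of_mul_le_mul_right h3 (hL0 h)
    rw [← mul_div_assoc, div_le_iff₀ hω0] at h4
    have h5 : 0 ≤ (1 - ε) * ω * r h :=
      mul_nonneg (mul_nonneg (sub_nonneg.mpr hε1) hω0.le) (Nat.cast_nonneg _)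
    show (r h' : ℝ) ≤ ω * r h
    linarith
  -- (10.4): `q₁^{r₁} ≤ q_h^{r_h}`
  have hR5 : ∀ h, (q i₀ : ℝ) ^ (r i₀) ≤ (q h : ℝ) ^ (r h) := by
    intro h
    rw [← Real.rpow_natCast, ← Real.rpow_natCast, Real.rpow_def_of_pos (hqR0 _),
      Real.rpow_def_of_pos (hqR0 _), Real.exp_le_exp, mul_comm, mul_comm (Real.log _)]
    exact hR1 h
  /- the auxiliary polynomial of the Index Theorem -/
  set rN : ℕ → ℕ := fun h => if hh : h < m then r ⟨h, hh⟩ else 1 with hrN_def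
  have hrN : ∀ h : Fin m, rN h = r h := fun h => by simp [hrN_def, h.isLt]
  have hrNfun : (fun h : Fin m => rN h) = r := funext hrN
  have hrN0 : ∀ h, h < m → 0 < rN h := fun h hh => by
    simp only [hrN_def, dif_pos hh]; exact hr0 _
  obtain ⟨P, hP0, hPdeg', hPind', hPht'⟩ := hB₀ ε hε0 m hmlog rN hrN0
  have hPdeg : ∀ h, P.degreeOf h ≤ r h := fun h => hrN h ▸ hPdeg' h
  have hPind : IndexGe P (fun _ : Fin m => β) r (m / 2 * (1 - ε)) := hrNfun ▸ hPind'
  have hPhtB : (height P : ℝ) ≤ B ^ (∑ h, r h) := by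
    have h1 : ((height P : ℕ) : ℝ) ≤ ((B₀ ^ (∑ h : Fin m, rN h) : ℕ) : ℝ) := by exact_mod_cast hPht'
    rw [hB_def]
    simpa [hrN] using h1
  /- Theorem 8A: the index at `(p_h/q_h)` is `≥ ε m` -/
  have hvanish := hD m hm0 ε δ hδ0 hδ1 hε0 hε36 r hr0 P hPdeg hPhtB hPind pn q hq0
    happrox hqD hR1 hR2
  /- Roth's lemma: the index at `(p_h/q_h)` is `≤ ε` -/
  have hPhtω : (height P : ℝ) ≤ (q i₀ : ℝ) ^ (omega m ε * (r i₀ : ℕ)) := by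
    have h2 : B ^ (∑ h, r h) ≤ B ^ (m * r₁) := pow_le_pow_right₀ hB1 hsum
    have h4 : (B ^ m) ^ r₁ < ((q i₀ : ℝ) ^ ω) ^ r₁ :=
      pow_lt_pow_left₀ (hqB i₀) (by positivity) hr₁pos.ne'
    have h5 : ((q i₀ : ℝ) ^ ω) ^ r₁ = (q i₀ : ℝ) ^ (ω * (r i₀ : ℕ)) := by
      rw [hri₀, Real.rpow_mul (hqR0 i₀).le, Real.rpow_natCast]
    rw [← h5, ← pow_mul] at *
    linarith
  obtain ⟨i, hi, hne⟩ := h10 m hm0 ε hε0 hε12 r hr0 hR4 pn q hq0 hcop hR5 hq3m P hP0 hPdeg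
    hPhtω
  /- the contradiction `ε < ε m` -/
  refine hne (hvanish i (lt_of_le_of_lt hi ?_))
  have : (1 : ℝ) < m := by exact_mod_cast lt_of_lt_of_le one_lt_two hm2
  exact lt_mul_of_one_lt_right hε0 this

end Roth

open Roth in
/-- **Roth's theorem from Roth's Lemma 10A** (Schmidt's §11, with the Index Theorem 7A
supplied by `Roth.indexTheorem` and Theorem 8A by `Roth.indexGe_nearbyRationals`): Roth's lemma,
stated in the vocabulary of `RothPrelim` exactly as Schmidt prints it with `γ = 1`
((10.1) `0 < ε < 1/12`; (10.3) `ω r_h ≥ r_{h+1}`; reduced `p_h/q_h`, `q_h > 0`;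
(10.4) `q_h^{r_h} ≥ q₁^{r₁}`; (10.5) `q_h^ω ≥ 2^{3m}`; `P ≠ 0` integer of degree `≤ r_h` in `X_h`;
(10.6) `|P| ≤ q₁^{ω r₁}` ⇒ some `P_i(p₁/q₁,…,pₘ/qₘ) ≠ 0` with `Σ i_h/r_h ≤ ε`), implies `roth`,
after the reduction to algebraic integers (Schmidt, p. 122: if `a₀` is the leading coefficient of
the minimal polynomial of `x` then `a₀ x` is an algebraic integer, still irrational and still
`LiouvilleWith p`). The index `0 : Fin m` is Schmidt's `h = 1`.
[cite: Schmidt1980, Ch. V §5 (p. 122) and §11] -/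
theorem roth_of_rothLemma
    (h10 : (∀ (m : ℕ) (hm : 0 < m) (ε : ℝ), 0 < ε → ε < 1 / 12 →
      ∀ (r : Fin m → ℕ), (∀ h, 0 < r h) →
        (∀ h h' : Fin m, (h : ℕ) + 1 = h' → (r h' : ℝ) ≤ omega m ε * r h) →
      ∀ (p : Fin m → ℤ) (q : Fin m → ℕ), (∀ h, 0 < q h) → (∀ h, Nat.Coprime (p h).natAbs (q h)) →
        (∀ h, (q ⟨0, hm⟩ : ℝ) ^ (r ⟨0, hm⟩) ≤ (q h : ℝ) ^ (r h)) →
        (∀ h, (2 : ℝ) ^ (3 * m) ≤ (q h : ℝ) ^ omega m ε) →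
      ∀ (P : MvPolynomial (Fin m) ℤ), P ≠ 0 → (∀ h, P.degreeOf h ≤ r h) →
        (height P : ℝ) ≤ (q ⟨0, hm⟩ : ℝ) ^ (omega m ε * r ⟨0, hm⟩) →
        ∃ i : Fin m →₀ ℕ, wt r i ≤ ε ∧ aeval (fun h => (p h : ℝ) / q h) (hasseD i P) ≠ 0)) :
    roth := by
  intro x hx hirr p hp hL
  haveI : Algebra.IsAlgebraic ℤ ℚ := IsLocalization.isAlgebraic ℚ (nonZeroDivisors ℤ)
  obtain ⟨y, hy0, hint⟩ := (hx.restrictScalars ℤ).exists_integral_multiple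
  rw [zsmul_eq_mul] at hint
  have hirrβ : Irrational ((y : ℝ) * x) := irrational_intCast_mul_iff.mpr ⟨hy0, hirr⟩
  have hLβ : LiouvilleWith p ((y : ℝ) * x) := hL.int_mul hy0
  have hdeg : 2 ≤ (minpoly ℤ ((y : ℝ) * x)).natDegree := by
    rw [minpoly.two_le_natDegree_iff hint]
    rintro ⟨z, hz⟩
    exact hirrβ ⟨(z : ℚ), by rw [Rat.cast_intCast, ← hz, eq_intCast]⟩
  exact false_of_liouvilleWith h10 hint hdeg hirrβ hp hLβ

end Literature.NumberTheory.DiophantineGeometry
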